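import Summits.HodgeConjecture.HodgeConjecture.Theorems.F0P6aStubGSPREAD   -- ★ p853238 TWIN (single part; head RE-STATED to the letters, body verbatim) of tree `Lines/F0_P6a_StubGSPREAD.lean` ED. 1 81473cadd2ed4a79 (106 l.; namespace KEPT)
import HarnessLib
import HarnessLib.Audit.LibrarySuggestionsDenyListCruxes

/-! # F0_P6a_StubGSPREAD — ED. 2 = SHIM (K6 P∕E column, LEAD F0P6-plan «M-142a» (B) ∕ «M-145d» ∕ deal «M-149b»; pen «L7» LA7-plan (g8); ★ hand LA2-p03 (g7); box LAref-P (g5) first ∕ LA4-r01 (g5) second)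

The one load-bearing declaration of the previous edition (tree sha16 81473cadd2ed4a79, 106 l., sorry-free, TRIO; the (A2) GSPREAD closer leaf of «L4» LA4-p03 (g2))
now lives under the SAME namespace `Summit.HodgeConjecture.HodgeConjecture.Cruxes.HLiu418.F0P6aStubGSPREAD` in ★ `Theorems/F0P6aStubGSPREAD.lean` (p853238):
`theorem gspread_of_line : DualPairOfAmpleRigidified → RecordESpreadCofinal` — head RE-STATED from `type_of% @F0P6aPELSpread.stub_GSPREAD` to the letters (P-side order of record,
LAref-P (g5) #47; statement identity = type-hash row `stub_GSPREAD` ≡ `gspread_of_line`, LAref-P #107), tactic body and docstring (`[cite:]` letters with `(print: …)` locators) VERBATIM,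
imports ★ `Theorems.F0P6aPELSpreadDefs` (home of `RecordESpreadCofinal` ∕ `stageLocLeg` ∕ `IsStageLocalisationAt`) + ★ `PELTupleSpreadLocalisedOfLetter` (p849094) + ★ `PlaceResidueCharacteristicRows` (p847908).
This module keeps its name so that its one tree importer (MAIN `F0_P6a_ModuliDatum.lean` :15, reading `F0P6aStubGSPREAD.gspread_of_line` by name at :650 inside
`spread_of_parts F0P6aStubGSPREAD.gspread_of_line stub_INJ0 …`) resolves unchanged through the import above.  It declares nothing.
NOT RE-HOMED, by design («M-149b» (iv)(v)): the same-statement pin `example : type_of% @F0P6aPELSpread.stub_GSPREAD := @gspread_of_line` (its pin is the `Lines` hub socket; the live tie is MAIN :650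
elaborating through this shim) and `spread_of_line_of_gspread : DualPairOfAmpleRigidified → RecordPELSpreadCofinal` — RETIRED (r7), class «M-142e» (ii): its body instantiates the hub socket
`F0P6aPELSpread.stub_ELAWS` (`sorry`) and it has 0 callers in the tree ⇒ not re-homable sorry-free; no alias.  CLOSURE-NAMES: MAIN imports the hub `Lines.F0_P6a_PELSpread` directly (:13), so no module
departs any importer՚s closure through this edition; LEFT-AND-USED 0.
ORDER NOTE: written on the LEAD՚s K6 shim-wave word together with the other shims of that wave; its `Lines` rev-closure by name (`F0_P6a_ModuliDatum`, `F0_D9opRoad2`, `F0_AlbCm`) re-makes in the same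
request (NO-CROSS-IMPORT: no environment may hold the `Lines/` ORIGINAL of this module together with its ★ twin — both declare `…F0P6aStubGSPREAD.gspread_of_line`); an importer smoke that reads
«environment already contains …» before that request is BUILT is this order note, not a defect.  Edition history stays in the line card and in git; future changes are ★-side proposals on the `Theorems/` file.
HC_CM is proved only modulo the 7 printed citations (2 remaining named inputs: hLiu418 = stmt-HodgeConjecture-24832, h413 = stmt-HodgeConjecture-24833) until rung 0 closes; count-neutral (0 `sorry`, 0 socket, 0 declarations). -/
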